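import Summits.BirchSwinnertonDyer.BirchSwinnertonDyer.Theorems.GenusKolyvaginAtTwoPowDvdShaCardAtTwoRTOrderFourAuxiliary
import HarnessLib

/-!
# Route `GenusKolyvaginAtTwo`, crux L_T `PowDvdShaCardAtTwoRT` (stmt-BirchSwinnertonDyer-23242), LINE 18 stub L, bottom rung:
# THE ORDER-4 AUXILIARY CLASS UNDER ARBITRARY LOCAL CONDITIONS ON `T` — `∃ y ∈ H¹_{𝓛, ⊤ on T}(ℚ, E[4])` with
# `loc_u y ∈ M_u` (`u ∈ T`) and `2y ≠ 0`, as soon as `8^{#T} < ∏_u #M_u`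

Width seat `bsd-line-gk2-p4` g18 (cell `bsd-f1-sign2`), `--supports 23242 --as helper`.  THEOREMS ONLY; no `sorry`; standard
axioms.  BSD is NOT proved by any of this; neither is the crux nor stub L.

WHY (LEAD memo `Cruxes/PowDvdShaCardAtTwoRT/Lines/plus-descent-lead-g16.md` §2, §7 (i), §8).  The bottom-rung engine for index-≥2
witnesses pairs `X = 2·desc c₂(nℓ′)` with an auxiliary `y ∈ H¹(ℚ, E[4])` of ORDER 4, Kummer off the primes of `n`, FREE at the
`k ≥ 1` non-deep own primes `s`, and CONSTRAINED at the deep own primes `t` to a local subgroup `M_ℓ` of order `8` (memo §8: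
`M_ℓ = (2•)⁻¹ H¹_tr = H¹_tr ⊕ H¹_f[2]`, which makes the `t`-terms of the reciprocity vanish by bilinearity).  The LEAD's
`…RTOrderFourAuxiliary.exists_mem_kummerOutside_four_two_nsmul_ne_zero` (p698989) is the instance with EVERY place of `T` free
(`t = ∅`).  This file is the general socket: the SAME conclusion for ARBITRARY local conditions `M_u ≤ H¹(ℚ_u, E[4])` on `T`
under the single numerical hypothesis **`8^{#T} < ∏_{u∈T} #M_u`** (the two-level count: `#H¹(ℚ_u,E[2])·#H¹(ℚ_u,E[4]) = 4·16
= 8²` at every Kolyvagin place, so `exists_mem_solutions_nsmul_ne_zero_canonical` needs exactly `(8^{#T})² < (∏ #M_u)²`), and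
its S-bot corollary: `M_u = ⊤` at a non-empty set of free places and `8 ≤ #M_u` at the others.  After this file the ONLY local
datum the general engine instance still needs is the ORDER (`= 8`, or just `≥ 8`) of the deep-own-prime condition.
* `exists_mem_kummerOutside_four_two_nsmul_ne_zero_of_card` — arbitrary `M`, hypothesis `8 ^ T.card < ∏ u, Nat.card (M u)`.
* `exists_mem_kummerOutside_four_two_nsmul_ne_zero_of_free_of_eight_le` — `∃ u₀, M u₀ = ⊤` and `∀ u, 8 ≤ Nat.card (M u)`.
* `eight_pow_card_lt_prod_of_free_of_eight_le` — the arithmetic of the corollary (`16 · 8^{#T−1} > 8^{#T}`).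
HONEST FRAMING: bookkeeping over p698989 / p697101 / p697543 (all tree theorems); unconditional; closes nothing.
BSD is NOT proved by any of this.

References: [McCallumLMS1991] §2 Prop. 2.1, §5 Lemma 5.3 and proof of Prop. 5.2; [MilneADT2006] Ch. I Thm. 2.8, Cor. 2.3, Thm. 4.10.
-/

set_option autoImplicit false
-- the Theorems namespace of this sub repeats the summit name by design (D-0017 nested layout)
set_option linter.dupNamespace false

noncomputable section

open scoped Classical

open CategoryTheory Field NumberField IsDedekindDomain Function
open _root_.WeierstrassCurve
open Literature.NumberTheory.EllipticCurves
open Literature.NumberTheory.GaloisRepresentations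
open Literature.NumberTheory.GaloisCohomology
open Summit.BirchSwinnertonDyer.Rank1Residual.X11b.KummerPT
open Summit.BirchSwinnertonDyer.Rank1Residual.X11b.FiniteDuality
open Summit.BirchSwinnertonDyer.Rank1Residual.X11b.LocBridge Summit.BirchSwinnertonDyer.Rank1Residual.X11b.Levels
open scoped ContRepresentation

namespace Summit.BirchSwinnertonDyer.BirchSwinnertonDyer.Theorems.GenusExact.RelaxedCount

open Summit.BirchSwinnertonDyer.BirchSwinnertonDyer.Theorems.GenusExact.ReductionCyclic
open Summit.BirchSwinnertonDyer.BirchSwinnertonDyer.Theorems.GenusExact.LocalDualityOrder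

/-! ## §1 The arithmetic of the S-bot corollary -/

/-- **`8^{#T} < ∏_u m_u`** when every `m_u ≥ 8` and some `m_{u₀} = 16`: `∏ m_u ≥ 16 · 8^{#T−1} = 2 · 8^{#T}`. [folklore] -/
theorem eight_pow_card_lt_prod_of_free_of_eight_le {ι : Type*} [Fintype ι] (m : ι → ℕ)
    (h8 : ∀ u, 8 ≤ m u) {u₀ : ι} (h16 : m u₀ = 16) :
    8 ^ Fintype.card ι < ∏ u, m u := by
  classical
  rw [← Finset.card_univ, ← Finset.mul_prod_erase Finset.univ m (Finset.mem_univ u₀), h16]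
  have hcard : (Finset.univ.erase u₀).card + 1 = Finset.univ.card :=
    Finset.card_erase_add_one (Finset.mem_univ u₀)
  have hle : 8 ^ (Finset.univ.erase u₀).card ≤ ∏ u ∈ Finset.univ.erase u₀, m u :=
    Finset.pow_card_le_prod _ _ _ fun u _ ↦ h8 u
  calc 8 ^ (Finset.univ : Finset ι).card = 8 * 8 ^ (Finset.univ.erase u₀).card := by rw [← hcard, pow_succ']
    _ < 16 * 8 ^ (Finset.univ.erase u₀).card := Nat.mul_lt_mul_of_pos_right (by norm_num) (by positivity)
    _ ≤ 16 * ∏ u ∈ Finset.univ.erase u₀, m u := Nat.mul_le_mul_left _ hle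

variable (W : WeierstrassCurve ℚ) [W.IsElliptic] [W.IsGloballyMinimal]

/-! ## §2 The order-4 auxiliary class under arbitrary local conditions on `T` -/

/-- **The order-4 auxiliary class under ARBITRARY local conditions on `T`.**  `E/ℚ` with `Δ < 0` and `ρ̄_{E,2}` onto (so
`E(ℚ)[2] = 0`); `T` a finite set of places, each the place of a Gross–Kolyvagin prime `ℓ ≠ 2` of good reduction with
`Frob_ℓ = Frob_∞` on `E[2]` and `kolyvaginIndex ≥ 2`; `M_u ≤ H¹(ℚ_u, E[4])` ANY local conditions on `T` with
**`8^{#T} < ∏_{u∈T} #M_u`**.  Then **`∃ y ∈ H¹_{𝓛, ⊤ on T}(ℚ, E[4])` with `loc_u y ∈ M_u` for every `u ∈ T` and `2•y ≠ 0`**.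
Proof: `exists_mem_solutions_nsmul_ne_zero_canonical` at levels `(2, 4)`, level map `H¹(E[2] ↪ E[4])` (`…RTLevelRange`), local
counts `#H¹(ℚ_u, E[2]) = 4`, `#H¹(ℚ_u, E[4]) = 16` (`natCard_galoisCohomology_one_toLocal_two_pow_eq`), so the numerical hypothesis
reads `64^{#T} = (8^{#T})² < (∏ #M_u)²`.  The case `M = ⊤` is p698989; the S-bot engine takes `M_u = ⊤` at the free own primes and
the order-8 condition `(2•)⁻¹ H¹_tr` at the deep ones. [cite: McCallumLMS1991, §2 Prop. 2.1 and §5 proof of Prop. 5.2]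
[cite: MilneADT2006, Ch. I, Thm. 4.10] -/
theorem exists_mem_kummerOutside_four_two_nsmul_ne_zero_of_card (hΔ : W.Δ < 0) (hρ2 : W.HasSurjectiveModNGaloisRep 2)
    {K : Type} [Field K] [NumberField K] (T : Finset (Place ℚ))
    (hTK : ∀ u ∈ T, ∃ (v : HeightOneSpectrum (𝓞 ℚ)) (ℓ : ℕ) (_ : Fact ℓ.Prime), u = Sum.inr v ∧ ℓ ≠ 2 ∧ (ℓ : 𝓞 ℚ) ∈ v.asIdeal ∧
      W.HasGoodReductionAtPrime ℓ ∧ FrobEqFrobInfty W K 2 ℓ ∧ 2 ≤ Zhang2014.kolyvaginIndex W 2 ℓ)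
    (M : ∀ u : ↥T, AddSubgroup (galoisCohomology ((W.torsionGaloisModule ((2 ^ 2 : ℕ) : ℤ)).toLocal (u : Place ℚ)) 1))
    (hM : 8 ^ T.card < ∏ u : ↥T, Nat.card (M u)) :
    ∃ y ∈ kummerOutside W (2 ^ 2) T,
      (∀ u : ↥T, galoisCohomology.localization (W.torsionGaloisModule ((2 ^ 2 : ℕ) : ℤ)) (u : Place ℚ) 1 y ∈ M u) ∧
        2 • y ≠ 0 := by
  classical
  haveI : Fact (Nat.Prime 2) := ⟨Nat.prime_two⟩
  -- local counts on `T`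
  have hcount : ∀ (N : ℕ), N ≠ 0 → N ≤ 2 → ∀ u : ↥T,
      Nat.card (galoisCohomology ((W.torsionGaloisModule ((2 ^ N : ℕ) : ℤ)).toLocal (u : Place ℚ)) 1) = 4 ^ N := by
    intro N hN0 hN2 u
    obtain ⟨v, ℓ, hℓp, hu, hℓ2, hv, hgood, hFrob, hidx⟩ := hTK u u.2
    rw [hu]
    exact natCard_galoisCohomology_one_toLocal_two_pow_eq W hΔ hℓ2 hgood hFrob hv hN0 (hN2.trans hidx)
  -- Weil pairings at levels 2 and 4
  obtain ⟨e₂, hμ₂, hadd₁₂, hadd₂₂, halt₂, hnondeg₂, hgal₂⟩ :=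
    W.exists_weilPairing_holds (2 ^ 1) (by norm_num) (by norm_num)
  obtain ⟨e₄, hμ₄, hadd₁₄, hadd₂₄, halt₄, hnondeg₄, hgal₄⟩ :=
    W.exists_weilPairing_holds (2 ^ 2) (by norm_num) (by norm_num)
  -- product localisations
  set loc₂ : galoisCohomology (W.torsionGaloisModule ((2 ^ 1 : ℕ) : ℤ)) 1 →+
      (∀ u : ↥T, galoisCohomology ((W.torsionGaloisModule ((2 ^ 1 : ℕ) : ℤ)).toLocal (u : Place ℚ)) 1) :=
    AddMonoidHom.pi fun u ↦ galoisCohomology.localization (W.torsionGaloisModule ((2 ^ 1 : ℕ) : ℤ)) (u : Place ℚ) 1 with hloc₂d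
  set loc₄ : galoisCohomology (W.torsionGaloisModule ((2 ^ 2 : ℕ) : ℤ)) 1 →+
      (∀ u : ↥T, galoisCohomology ((W.torsionGaloisModule ((2 ^ 2 : ℕ) : ℤ)).toLocal (u : Place ℚ)) 1) :=
    AddMonoidHom.pi fun u ↦ galoisCohomology.localization (W.torsionGaloisModule ((2 ^ 2 : ℕ) : ℤ)) (u : Place ℚ) 1 with hloc₄d
  have hloc₂ : ∀ c u, loc₂ c u = galoisCohomology.localization (W.torsionGaloisModule ((2 ^ 1 : ℕ) : ℤ)) (u : Place ℚ) 1 c :=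
    fun c u ↦ rfl
  have hloc₄ : ∀ c u, loc₄ c u = galoisCohomology.localization (W.torsionGaloisModule ((2 ^ 2 : ℕ) : ℤ)) (u : Place ℚ) 1 c :=
    fun c u ↦ rfl
  -- the level map
  have hdvd : ((2 ^ 1 : ℕ) : ℤ) ∣ ((2 ^ (1 + 1) : ℕ) : ℤ) := by norm_num
  have hι : Injective (galoisCohomology.map (W.torsionInclusion hdvd) 1) := by
    intro x y hxy
    rw [map_torsionInclusion_one_apply, map_torsionInclusion_one_apply] at hxy
    exact VisiblePairAtTwo.torsionH1OfDvd_pow_injective W (p := 2) (VisiblePairAtTwo.torsionBy_two_eq_bot_of_surj W hρ2) hdvd hxy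
  -- the numerical hypothesis: `∏ 4 · ∏ 16 = (8 ^ #T)² < (∏ #M_u)²`
  have h2 : ∀ u : ↥T, Nat.card (galoisCohomology ((W.torsionGaloisModule ((2 ^ 1 : ℕ) : ℤ)).toLocal (u : Place ℚ)) 1) = 4 :=
    fun u ↦ by rw [hcount 1 one_ne_zero (by norm_num) u, pow_one]
  have h4 : ∀ u : ↥T, Nat.card (galoisCohomology ((W.torsionGaloisModule ((2 ^ (1 + 1) : ℕ) : ℤ)).toLocal (u : Place ℚ)) 1) =
      16 := fun u ↦ by rw [hcount (1 + 1) (by norm_num) le_rfl u]; norm_num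
  have hlt : (∏ u : ↥T, Nat.card (galoisCohomology ((W.torsionGaloisModule ((2 ^ 1 : ℕ) : ℤ)).toLocal (u : Place ℚ)) 1)) *
      (∏ u : ↥T, Nat.card (galoisCohomology ((W.torsionGaloisModule ((2 ^ (1 + 1) : ℕ) : ℤ)).toLocal (u : Place ℚ)) 1)) <
      (∏ u : ↥T, Nat.card (M u)) ^ 2 := by
    rw [Finset.prod_congr rfl fun u _ ↦ h2 u, Finset.prod_congr rfl fun u _ ↦ h4 u, Finset.prod_const, Finset.prod_const,
      Finset.card_univ, Fintype.card_coe, ← mul_pow]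
    have h64 : (4 * 16) ^ T.card = (8 ^ T.card) ^ 2 := by rw [sq, ← mul_pow]; norm_num
    rw [h64]
    exact Nat.pow_lt_pow_left hM two_ne_zero
  obtain ⟨y, hy, hy2⟩ := exists_mem_solutions_nsmul_ne_zero_canonical W 2 1 (1 + 1) e₂ hμ₂ hadd₁₂ hadd₂₂ hgal₂ halt₂ hnondeg₂
    e₄ hμ₄ hadd₁₄ hadd₂₄ hgal₄ halt₄ hnondeg₄ one_pos (by norm_num) 2 T loc₂ hloc₂ loc₄ hloc₄
    (galoisCohomology.map (W.torsionInclusion hdvd) 1) hι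
    (fun c hc ↦ (map_torsionInclusion_mem_kummerOutside_iff W hdvd T c).mpr hc)
    (fun y hyT hy ↦ exists_map_torsionInclusion_eq_of_mem_kummerOutside W 2
      (VisiblePairAtTwo.torsionBy_two_eq_bot_of_surj W hρ2) 1 1 hdvd T y hyT (by simpa using hy))
    (fun c u hc ↦ by
      rw [hloc₄]
      exact localization_map_torsionInclusion_eq_zero W hdvd (u : Place ℚ) c (by rw [← hloc₂]; exact hc))
    M hlt
  have hyM : y ∈ (AddSubgroup.pi Set.univ M).comap loc₄ := (AddSubgroup.mem_inf.mp hy).2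
  rw [AddSubgroup.mem_comap, AddSubgroup.mem_pi] at hyM
  refine ⟨y, (AddSubgroup.mem_inf.mp hy).1, fun u ↦ ?_, hy2⟩
  rw [← hloc₄]
  exact hyM u (Set.mem_univ _)

/-- **The S-bot corollary**: with `M_u = ⊤` at SOME place `u₀ ∈ T` (a free own prime — the engine has `k ≥ 1` of them) and
`8 ≤ #M_u` at every place of `T` (the deep own primes carry a condition of order `8`; `⊤` has order `16`), there is
`y ∈ H¹_{𝓛, ⊤ on T}(ℚ, E[4])` with `loc_u y ∈ M_u` (`u ∈ T`) and `2•y ≠ 0`. [cite: McCallumLMS1991, §5 proof of Prop. 5.2] -/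
theorem exists_mem_kummerOutside_four_two_nsmul_ne_zero_of_free_of_eight_le (hΔ : W.Δ < 0)
    (hρ2 : W.HasSurjectiveModNGaloisRep 2)
    {K : Type} [Field K] [NumberField K] (T : Finset (Place ℚ))
    (hTK : ∀ u ∈ T, ∃ (v : HeightOneSpectrum (𝓞 ℚ)) (ℓ : ℕ) (_ : Fact ℓ.Prime), u = Sum.inr v ∧ ℓ ≠ 2 ∧ (ℓ : 𝓞 ℚ) ∈ v.asIdeal ∧
      W.HasGoodReductionAtPrime ℓ ∧ FrobEqFrobInfty W K 2 ℓ ∧ 2 ≤ Zhang2014.kolyvaginIndex W 2 ℓ)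
    (M : ∀ u : ↥T, AddSubgroup (galoisCohomology ((W.torsionGaloisModule ((2 ^ 2 : ℕ) : ℤ)).toLocal (u : Place ℚ)) 1))
    (hfree : ∃ u₀ : ↥T, M u₀ = ⊤) (h8 : ∀ u : ↥T, 8 ≤ Nat.card (M u)) :
    ∃ y ∈ kummerOutside W (2 ^ 2) T,
      (∀ u : ↥T, galoisCohomology.localization (W.torsionGaloisModule ((2 ^ 2 : ℕ) : ℤ)) (u : Place ℚ) 1 y ∈ M u) ∧
        2 • y ≠ 0 := by
  classical
  obtain ⟨u₀, hu₀⟩ := hfree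
  have h16 : Nat.card (M u₀) = 16 := by
    obtain ⟨v, ℓ, hℓp, hu, hℓ2, hv, hgood, hFrob, hidx⟩ := hTK u₀ u₀.2
    rw [hu₀, AddSubgroup.card_top]
    have h := natCard_galoisCohomology_one_toLocal_two_pow_eq W hΔ hℓ2 hgood hFrob hv two_ne_zero hidx
    rw [← hu] at h
    rw [h]; norm_num
  have hM : 8 ^ T.card < ∏ u : ↥T, Nat.card (M u) := by
    have h := eight_pow_card_lt_prod_of_free_of_eight_le (fun u : ↥T ↦ Nat.card (M u)) h8 h16
    rwa [Fintype.card_coe] at h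
  exact exists_mem_kummerOutside_four_two_nsmul_ne_zero_of_card W hΔ hρ2 T hTK M hM

end Summit.BirchSwinnertonDyer.BirchSwinnertonDyer.Theorems.GenusExact.RelaxedCount

end
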